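import Literature.NumberTheory.Sieve.SmoothCanonicalPrefix
import Literature.NumberTheory.Sieve.VinogradovExpSumTools
import HarnessLib

/-!
# Harper's minor-arc estimate, I: the Cauchy–Schwarz reduction

Topic `Literature/NumberTheory/Sieve`; a PROVED tool file toward
`Literature.NumberTheory.DiophantineGeometry.XYZUpperHalf` ([Harper2016, Cor. 1]). This is the
first half of the proof of Theorem 1 of op. cit. (§3, from the first display to the display before
the case analysis "Now if `p ∤ q`…"): after the canonical factorisation `n = m n'`
(`sum_smooth_Ioc_eq_sum_sum`), the prefixes `m` are grouped dyadically, Cauchy–Schwarz is applied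
over `m`, the condition that `m` be smooth with `P(m) = p` is dropped (`m = m' p`, `m'` ranging
over ALL integers of the dyadic range), the square is expanded and the sum over `m'` — a geometric
progression over a set of consecutive integers — is bounded by `min(V, 1/(2‖p(n₁−n₂)θ‖))`:

* `norm_sum_smooth_fourierChar_le` — for `1 ≤ W ≤ A ≤ x`, `y ≥ 2` and every real `θ`,
  `|∑_{A < n ≤ x, n ∈ S(y)} e(nθ)| ≤ ∑_{j ≤ log₂ y} (#𝓜_j)^{1/2} ·
     (∑_{p ≤ y} ∑_{n₁, n₂ ∈ S(y) ∩ [1, x/(u₀2^j)]} min(u₀2^j/p + 1, 1/(2‖p(n₁−n₂)θ‖)))^{1/2}`,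
  where `u₀ = ⌊W⌋ + 1`, `𝓜_j = {m ∈ 𝓜 : u₀2^j ≤ m < u₀2^{j+1}}` (so `#𝓜_j ≤ Ψ(u₀ 2^{j+1}, y)`),
  and `min(V, 1/(2‖t‖))` is `Vinogradov.geomBound V t`.

## References

* A. J. Harper, Compositio Math. 152 (2016) 1121–1158, §3 (proof of Theorem 1, first page)
  [Harper2016].
* M. B. Nathanson, *Additive Number Theory: The Classical Bases*, GTM 164, Lemma 4.7 (geometric
  sums) [Nathanson1996].
-/

noncomputable section

open Finset Real Complex
open scoped FourierTransform ComplexConjugate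
open Literature.NumberTheory.Sieve.Vinogradov

namespace Literature.NumberTheory.Sieve

/-! ### Generic tools -/

/-- A finite set of naturals closed under betweenness is the interval `[min, max]`. [folklore] -/
theorem eq_Icc_of_ordConnected {T : Finset ℕ} (hT : ∀ a ∈ T, ∀ b ∈ T, ∀ c, a ≤ c → c ≤ b → c ∈ T)
    (hne : T.Nonempty) : T = Finset.Icc (T.min' hne) (T.max' hne) := by
  ext c
  constructor
  · intro hc; rw [Finset.mem_Icc]; exact ⟨T.min'_le c hc, T.le_max' c hc⟩
  · intro hc; rw [Finset.mem_Icc] at hc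
    exact hT _ (T.min'_mem hne) _ (T.max'_mem hne) c hc.1 hc.2

/-- **Geometric sums over a set of consecutive positive integers**:
`|∑_{m ∈ T} e(m t)| ≤ min(V, 1/(2‖t‖))` when `T ⊆ ℕ_{≥1}` is closed under betweenness and `#T ≤ V`.
[cite: Nathanson1996, §4.4, Lemma 4.7] -/
theorem norm_sum_fourierChar_le_geomBound_of_ordConnected {T : Finset ℕ} {V : ℝ}
    (hT : ∀ a ∈ T, ∀ b ∈ T, ∀ c, a ≤ c → c ≤ b → c ∈ T) (h1 : ∀ a ∈ T, 1 ≤ a)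
    (hV : (T.card : ℝ) ≤ V) (t : ℝ) :
    ‖∑ m ∈ T, (𝐞 ((m : ℝ) * t) : ℂ)‖ ≤ geomBound V t := by
  rcases T.eq_empty_or_nonempty with hemp | hne
  · rw [hemp, Finset.sum_empty, norm_zero]
    exact geomBound_nonneg (le_trans (by positivity) hV) t
  have hTeq := eq_Icc_of_ordConnected hT hne
  set a := T.min' hne
  set b := T.max' hne
  have ha1 : 1 ≤ a := h1 a (T.min'_mem hne)
  have hIcc : Finset.Icc a b = Finset.Ioc (a - 1) b := by
    ext c; simp only [Finset.mem_Icc, Finset.mem_Ioc]; omega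
  have hcard : ((b - (a - 1) : ℕ) : ℝ) ≤ V := by
    have : T.card = b - (a - 1) := by rw [hTeq, Nat.card_Icc]; omega
    rw [← this]; exact hV
  rw [hTeq, hIcc]
  exact norm_sum_Ioc_fourierChar_le_geomBound t hcard

/-- `‖∑ a‖² = ∑∑ a_{n₁} conj(a_{n₂})` (as complex numbers). [folklore] -/
theorem normSq_sum_eq_sum_sum {ι : Type*} (s : Finset ι) (a : ι → ℂ) :
    ((‖∑ n ∈ s, a n‖ ^ 2 : ℝ) : ℂ) = ∑ n₁ ∈ s, ∑ n₂ ∈ s, a n₁ * conj (a n₂) := by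
  rw [← Complex.normSq_eq_norm_sq, Complex.normSq_eq_conj_mul_self, map_sum,
    Finset.sum_mul_sum, Finset.sum_comm]
  refine Finset.sum_congr rfl fun n₁ _ => Finset.sum_congr rfl fun n₂ _ => ?_
  ring

/-- Cauchy–Schwarz: `|∑_{m ∈ S} c_m| ≤ (#S)^{1/2} (∑ |c_m|²)^{1/2}`. [folklore] -/
theorem norm_sum_le_sqrt_card_mul_sqrt {ι : Type*} (S : Finset ι) (c : ι → ℂ) :
    ‖∑ m ∈ S, c m‖ ≤ Real.sqrt S.card * Real.sqrt (∑ m ∈ S, ‖c m‖ ^ 2) := by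
  have h1 : ‖∑ m ∈ S, c m‖ ≤ ∑ m ∈ S, ‖c m‖ := norm_sum_le _ _
  have h2 : (∑ m ∈ S, ‖c m‖) ^ 2 ≤ S.card * ∑ m ∈ S, ‖c m‖ ^ 2 := by
    have := sq_sum_le_card_mul_sum_sq (s := S) (f := fun m => ‖c m‖)
    exact_mod_cast this
  have h3 : ∑ m ∈ S, ‖c m‖ ≤ Real.sqrt S.card * Real.sqrt (∑ m ∈ S, ‖c m‖ ^ 2) := by
    rw [← Real.sqrt_mul (Nat.cast_nonneg _), ← Real.sqrt_sq (Finset.sum_nonneg fun m _ => norm_nonneg _)]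
    exact Real.sqrt_le_sqrt h2
  exact h1.trans h3

/-- A finite set of naturals lying in a real interval `[a, a + ℓ)` has at most `ℓ + 1` elements.
[folklore] -/
theorem card_le_of_subset_Ico_real {T : Finset ℕ} {a ℓ : ℝ} (hℓ : 0 ≤ ℓ)
    (h : ∀ m ∈ T, a ≤ (m : ℝ) ∧ (m : ℝ) < a + ℓ) : (T.card : ℝ) ≤ ℓ + 1 := by
  have hsub : T ⊆ Finset.Ico ⌈a⌉₊ ⌈a + ℓ⌉₊ := by
    intro m hm
    obtain ⟨h1, h2⟩ := h m hm
    rw [Finset.mem_Ico]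
    exact ⟨Nat.ceil_le.mpr h1, (Nat.lt_ceil).mpr h2⟩
  have h1 : T.card ≤ ⌈a + ℓ⌉₊ - ⌈a⌉₊ := (Finset.card_le_card hsub).trans (by rw [Nat.card_Ico])
  have h2 : ⌈a + ℓ⌉₊ ≤ ⌈a⌉₊ + ⌈ℓ⌉₊ := Nat.ceil_add_le _ _
  have h3 : (⌈ℓ⌉₊ : ℝ) < ℓ + 1 := Nat.ceil_lt_add_one hℓ
  have h4 : (T.card : ℝ) ≤ ⌈ℓ⌉₊ := by exact_mod_cast h1.trans (by omega)
  linarith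

/-! ### The setting of Theorem 1 -/

section Setting

variable (x A : ℝ) (y : ℕ) (θ : ℝ)

/-- The cofactors with all prime factors `≥ p`: `𝓑(p) = {1 ≤ n' ≤ x : n' ∈ S(y), n' = 1 ∨ p ≤ minFac n'}`.
[cite: Harper2016, §3] -/
def roughCofactors (p : ℕ) : Finset ℕ :=
  (Finset.Icc 1 ⌊x⌋₊).filter (fun n' => n' ∈ Nat.smoothNumbers (y + 1) ∧ (n' = 1 ∨ p ≤ n'.minFac))

/-- The inner sum `Φ_p(k) = ∑_{n' ∈ 𝓑(p), A < k n' ≤ x} e(k n' θ)`. [cite: Harper2016, §3] -/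
def innerSum (p k : ℕ) : ℂ :=
  ∑ n' ∈ roughCofactors x y p,
    (if A < (k : ℝ) * n' ∧ (k : ℝ) * n' ≤ x then (𝐞 ((k : ℝ) * n' * θ) : ℂ) else 0)

variable {x A y θ}

/-- On the prefix set, the cofactor sum is `Φ_{P(m)}(m)`. [cite: Harper2016, §3] -/
theorem sum_cofactorSet_eq_innerSum (m : ℕ) :
    ∑ n' ∈ cofactorSet y A x m, (𝐞 ((m : ℝ) * n' * θ) : ℂ) = innerSum x A y θ (lpf m) m := by
  rw [innerSum, ← Finset.sum_filter]
  congr 1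
  ext n'
  simp only [cofactorSet, roughCofactors, Finset.mem_filter]
  tauto

end Setting

/-! ### The bound for one dyadic class and one prime -/

/-- For a prime `p`, a dyadic range `[U, 2U)` (`U ≥ 1` an integer) and `x ≥ A ≥ 0`:
`∑_{m' : U ≤ m'p < 2U} |Φ_p(m' p)|² ≤ ∑_{n₁, n₂ ∈ S(y) ∩ [1, x/U]} min(U/p + 1, 1/(2‖p(n₁−n₂)θ‖))`
(expand the square, swap, geometric series over the consecutive `m'` with `A < m'p nᵢ ≤ x`).
[cite: Harper2016, §3 (display after "Because we have `≪ Ψ(2^{j+1}qLy, y)` choices…" — its proof)] -/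
theorem sum_normSq_innerSum_le {x A θ : ℝ} {y p U : ℕ} (hp : 0 < p) (hU : 1 ≤ U) :
    ∑ m' ∈ (Finset.Icc 1 (2 * U)).filter (fun m' => U ≤ m' * p ∧ m' * p < 2 * U),
        ‖innerSum x A y θ p (m' * p)‖ ^ 2 ≤
      ∑ n₁ ∈ Nat.smoothNumbersUpTo ⌊x / U⌋₊ (y + 1), ∑ n₂ ∈ Nat.smoothNumbersUpTo ⌊x / U⌋₊ (y + 1),
        geomBound ((U : ℝ) / p + 1) ((p : ℝ) * ((n₁ : ℝ) - n₂) * θ) := by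
  classical
  set M := (Finset.Icc 1 (2 * U)).filter (fun m' => U ≤ m' * p ∧ m' * p < 2 * U) with hM
  set B := roughCofactors x y p with hB
  set S := Nat.smoothNumbersUpTo ⌊x / U⌋₊ (y + 1) with hS
  have hp0 : (0 : ℝ) < p := by exact_mod_cast hp
  have hU0 : (0 : ℝ) < U := by exact_mod_cast hU
  set V : ℝ := (U : ℝ) / p + 1 with hV
  have hV0 : 0 ≤ V := by positivity
  -- the conditions
  set cond : ℕ → ℕ → Prop := fun k n' => A < (k : ℝ) * n' ∧ (k : ℝ) * n' ≤ x with hcond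
  -- (1) expand the squares and swap
  have hexp : ∀ m' : ℕ, ((‖innerSum x A y θ p (m' * p)‖ ^ 2 : ℝ) : ℂ) =
      ∑ n₁ ∈ B, ∑ n₂ ∈ B, (if cond (m' * p) n₁ ∧ cond (m' * p) n₂ then
        (𝐞 ((m' : ℝ) * ((p : ℝ) * ((n₁ : ℝ) - n₂) * θ)) : ℂ) else 0) := by
    intro m'
    rw [innerSum, ← hB, normSq_sum_eq_sum_sum]
    refine Finset.sum_congr rfl fun n₁ _ => Finset.sum_congr rfl fun n₂ _ => ?_
    simp only [hcond]
    by_cases h1 : (A < ((m' * p : ℕ) : ℝ) * n₁ ∧ ((m' * p : ℕ) : ℝ) * n₁ ≤ x) <;>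
    by_cases h2 : (A < ((m' * p : ℕ) : ℝ) * n₂ ∧ ((m' * p : ℕ) : ℝ) * n₂ ≤ x) <;>
    simp only [h1, h2, and_self, and_true, and_false, if_true, if_false,
      mul_zero, zero_mul, map_zero]
    rw [← Circle.coe_inv_eq_conj, ← AddChar.map_neg_eq_inv, ← Circle.coe_mul,
      ← AddChar.map_add_eq_mul, ← sub_eq_add_neg]
    congr 2; push_cast; ring
  have hswap : ((∑ m' ∈ M, ‖innerSum x A y θ p (m' * p)‖ ^ 2 : ℝ) : ℂ) =
      ∑ n₁ ∈ B, ∑ n₂ ∈ B, ∑ m' ∈ M.filter (fun m' => cond (m' * p) n₁ ∧ cond (m' * p) n₂),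
        (𝐞 ((m' : ℝ) * ((p : ℝ) * ((n₁ : ℝ) - n₂) * θ)) : ℂ) := by
    rw [Complex.ofReal_sum, Finset.sum_congr rfl fun m' _ => hexp m', Finset.sum_comm]
    refine Finset.sum_congr rfl fun n₁ _ => ?_
    rw [Finset.sum_comm]
    refine Finset.sum_congr rfl fun n₂ _ => ?_
    exact (Finset.sum_filter _ _).symm
  -- (2) the inner `m'`-sets are sets of consecutive positive integers of size `≤ V`
  have hMmem : ∀ m' ∈ M, 1 ≤ m' ∧ (U : ℝ) ≤ (m' : ℝ) * p ∧ (m' : ℝ) * p < 2 * U := by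
    intro m' hm'
    rw [hM, Finset.mem_filter, Finset.mem_Icc] at hm'
    obtain ⟨⟨h1, -⟩, h2, h3⟩ := hm'
    exact ⟨h1, by exact_mod_cast h2, by exact_mod_cast h3⟩
  have hMcard : (M.card : ℝ) ≤ V := by
    rw [hV]
    have := card_le_of_subset_Ico_real (T := M) (a := (U : ℝ) / p) (ℓ := (U : ℝ) / p)
      (by positivity) (fun m' hm' => ?_)
    · linarith
    · obtain ⟨-, h2, h3⟩ := hMmem m' hm'
      constructor
      · rw [div_le_iff₀ hp0]; exact h2
      · rw [← add_div, lt_div_iff₀ hp0]; linarith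
  have hgeom : ∀ n₁ n₂ : ℕ,
      ‖∑ m' ∈ M.filter (fun m' => cond (m' * p) n₁ ∧ cond (m' * p) n₂),
        (𝐞 ((m' : ℝ) * ((p : ℝ) * ((n₁ : ℝ) - n₂) * θ)) : ℂ)‖ ≤
        geomBound V ((p : ℝ) * ((n₁ : ℝ) - n₂) * θ) := by
    intro n₁ n₂
    set T := M.filter (fun m' => cond (m' * p) n₁ ∧ cond (m' * p) n₂) with hT
    apply norm_sum_fourierChar_le_geomBound_of_ordConnected
    · -- betweenness: all conditions are monotone in `m'`
      intro a ha b hb c hac hcb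
      rw [hT, Finset.mem_filter, hM, Finset.mem_filter, Finset.mem_Icc] at ha hb ⊢
      obtain ⟨⟨⟨ha1, -⟩, haU, -⟩, ⟨haA1, -⟩, ⟨haA2, -⟩⟩ := ha
      obtain ⟨⟨⟨-, hb2⟩, -, hbU⟩, ⟨-, hbx1⟩, ⟨-, hbx2⟩⟩ := hb
      have hca : (a : ℝ) ≤ c := by exact_mod_cast hac
      have hcb' : (c : ℝ) ≤ b := by exact_mod_cast hcb
      refine ⟨⟨⟨by omega, by omega⟩, le_trans haU (Nat.mul_le_mul_right _ hac),
        lt_of_le_of_lt (Nat.mul_le_mul_right _ hcb) hbU⟩, ⟨?_, ?_⟩, ⟨?_, ?_⟩⟩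
      · calc A < ((a * p : ℕ) : ℝ) * n₁ := haA1
          _ ≤ ((c * p : ℕ) : ℝ) * n₁ := by push_cast; gcongr
      · calc ((c * p : ℕ) : ℝ) * n₁ ≤ ((b * p : ℕ) : ℝ) * n₁ := by push_cast; gcongr
          _ ≤ x := hbx1
      · calc A < ((a * p : ℕ) : ℝ) * n₂ := haA2
          _ ≤ ((c * p : ℕ) : ℝ) * n₂ := by push_cast; gcongr
      · calc ((c * p : ℕ) : ℝ) * n₂ ≤ ((b * p : ℕ) : ℝ) * n₂ := by push_cast; gcongr
          _ ≤ x := hbx2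
    · intro a ha
      exact (hMmem a (Finset.mem_filter.mp ha).1).1
    · exact le_trans (by exact_mod_cast Finset.card_le_card (Finset.filter_subset _ M)) hMcard
  -- (3) nonempty inner sets force `n₁, n₂ ≤ x/U`
  have hforce : ∀ n₁ ∈ B, ∀ n₂ ∈ B,
      (M.filter (fun m' => cond (m' * p) n₁ ∧ cond (m' * p) n₂)).Nonempty → n₁ ∈ S ∧ n₂ ∈ S := by
    intro n₁ hn₁ n₂ hn₂ ⟨m', hm'⟩
    rw [Finset.mem_filter] at hm'
    obtain ⟨hm'M, ⟨-, h1x⟩, ⟨-, h2x⟩⟩ := hm'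
    obtain ⟨-, hUm, -⟩ := hMmem m' hm'M
    have hk0 : (0 : ℝ) < (m' : ℝ) * p := lt_of_lt_of_le hU0 hUm
    rw [hB, roughCofactors, Finset.mem_filter] at hn₁ hn₂
    have key : ∀ n : ℕ, n ∈ Nat.smoothNumbers (y + 1) → ((m' * p : ℕ) : ℝ) * n ≤ x → n ∈ S := by
      intro n hn hnx
      rw [hS, Nat.mem_smoothNumbersUpTo]
      refine ⟨Nat.le_floor ?_, hn⟩
      rw [le_div_iff₀ hU0]
      push_cast at hnx
      calc (n : ℝ) * U ≤ n * ((m' : ℝ) * p) := by gcongr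
        _ = (m' : ℝ) * p * n := by ring
        _ ≤ x := hnx
    exact ⟨key n₁ hn₁.2.1 h1x, key n₂ hn₂.2.1 h2x⟩
  -- (4) assemble
  have hreal : ∑ m' ∈ M, ‖innerSum x A y θ p (m' * p)‖ ^ 2 =
      ‖((∑ m' ∈ M, ‖innerSum x A y θ p (m' * p)‖ ^ 2 : ℝ) : ℂ)‖ := by
    rw [Complex.norm_real, Real.norm_eq_abs, abs_of_nonneg (Finset.sum_nonneg fun _ _ => by positivity)]
  rw [hreal, hswap]
  calc ‖∑ n₁ ∈ B, ∑ n₂ ∈ B, ∑ m' ∈ M.filter (fun m' => cond (m' * p) n₁ ∧ cond (m' * p) n₂),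
          (𝐞 ((m' : ℝ) * ((p : ℝ) * ((n₁ : ℝ) - n₂) * θ)) : ℂ)‖
      ≤ ∑ n₁ ∈ B, ‖∑ n₂ ∈ B, ∑ m' ∈ M.filter (fun m' => cond (m' * p) n₁ ∧ cond (m' * p) n₂),
          (𝐞 ((m' : ℝ) * ((p : ℝ) * ((n₁ : ℝ) - n₂) * θ)) : ℂ)‖ := norm_sum_le _ _
    _ ≤ ∑ n₁ ∈ B, ∑ n₂ ∈ B, ‖∑ m' ∈ M.filter (fun m' => cond (m' * p) n₁ ∧ cond (m' * p) n₂),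
          (𝐞 ((m' : ℝ) * ((p : ℝ) * ((n₁ : ℝ) - n₂) * θ)) : ℂ)‖ :=
        Finset.sum_le_sum fun n₁ _ => norm_sum_le _ _
    _ ≤ ∑ n₁ ∈ B, ∑ n₂ ∈ B, (if n₁ ∈ S ∧ n₂ ∈ S then geomBound V ((p : ℝ) * ((n₁ : ℝ) - n₂) * θ) else 0) := by
        refine Finset.sum_le_sum fun n₁ hn₁ => Finset.sum_le_sum fun n₂ hn₂ => ?_
        split_ifs with h
        · exact hgeom n₁ n₂
        · rw [Finset.not_nonempty_iff_eq_empty.mp (fun hne => h (hforce n₁ hn₁ n₂ hn₂ hne)),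
            Finset.sum_empty, norm_zero]
    _ = ∑ n₁ ∈ B.filter (· ∈ S), ∑ n₂ ∈ B.filter (· ∈ S), geomBound V ((p : ℝ) * ((n₁ : ℝ) - n₂) * θ) := by
        rw [Finset.sum_filter]
        refine Finset.sum_congr rfl fun n₁ _ => ?_
        rw [Finset.sum_filter]
        split_ifs with h1
        · refine Finset.sum_congr rfl fun n₂ _ => ?_
          simp only [h1, true_and]
        · rw [Finset.sum_eq_zero]
          intro n₂ _
          rw [if_neg (fun h => h1 h.1)]
    _ ≤ ∑ n₁ ∈ S, ∑ n₂ ∈ S, geomBound V ((p : ℝ) * ((n₁ : ℝ) - n₂) * θ) := by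
        have hsub : B.filter (· ∈ S) ⊆ S := fun n hn => (Finset.mem_filter.mp hn).2
        calc ∑ n₁ ∈ B.filter (· ∈ S), ∑ n₂ ∈ B.filter (· ∈ S), geomBound V ((p : ℝ) * ((n₁ : ℝ) - n₂) * θ)
            ≤ ∑ n₁ ∈ B.filter (· ∈ S), ∑ n₂ ∈ S, geomBound V ((p : ℝ) * ((n₁ : ℝ) - n₂) * θ) :=
              Finset.sum_le_sum fun n₁ _ => Finset.sum_le_sum_of_subset_of_nonneg hsub
                (fun n₂ _ _ => geomBound_nonneg hV0 _)
          _ ≤ ∑ n₁ ∈ S, ∑ n₂ ∈ S, geomBound V ((p : ℝ) * ((n₁ : ℝ) - n₂) * θ) :=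
              Finset.sum_le_sum_of_subset_of_nonneg hsub
                (fun n₁ _ _ => Finset.sum_nonneg fun n₂ _ => geomBound_nonneg hV0 _)

/-! ### The Cauchy–Schwarz reduction -/

/-- **Harper's minor-arc estimate, first half** (the Cauchy–Schwarz reduction). For
`1 ≤ W ≤ A ≤ x`, `y ≥ 2` and every real `θ`, with `u₀ = ⌊W⌋ + 1`, `U_j = u₀ 2^j`,
`𝓜_j = {m ∈ 𝓜 : ⌊log₂ (m/u₀)⌋ = j}` (`⊆ [U_j, 2U_j)`):
`|∑_{A < n ≤ x, n ∈ S(y)} e(nθ)| ≤ ∑_{j ≤ log₂ y} (#𝓜_j)^{1/2} (∑_{p ≤ y prime} ∑_{n₁,n₂ ∈ S(y) ∩ [1, x/U_j]}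
  min(U_j/p + 1, 1/(2‖p(n₁−n₂)θ‖)))^{1/2}`.
[cite: Harper2016, §3 (proof of Theorem 1: the decomposition, "≪ ∑_j √Ψ(2^{j+1}qLy, y) √(…)")] -/
theorem norm_sum_smooth_fourierChar_le {x A W θ : ℝ} {y : ℕ} (hW1 : 1 ≤ W) (hWA : W ≤ A)
    (hAx : A ≤ x) (hy : 2 ≤ y) :
    ‖∑ n ∈ (Finset.Ioc ⌊A⌋₊ ⌊x⌋₊).filter (· ∈ Nat.smoothNumbers (y + 1)), (𝐞 ((n : ℝ) * θ) : ℂ)‖ ≤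
      ∑ j ∈ Finset.range (Nat.log 2 y + 1),
        Real.sqrt (((prefixSet y W).filter (fun m => Nat.log 2 (m / (⌊W⌋₊ + 1)) = j)).card : ℝ) *
        Real.sqrt (∑ p ∈ (Finset.range (y + 1)).filter Nat.Prime,
          ∑ n₁ ∈ Nat.smoothNumbersUpTo ⌊x / (((⌊W⌋₊ + 1) * 2 ^ j : ℕ) : ℝ)⌋₊ (y + 1),
          ∑ n₂ ∈ Nat.smoothNumbersUpTo ⌊x / (((⌊W⌋₊ + 1) * 2 ^ j : ℕ) : ℝ)⌋₊ (y + 1),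
            geomBound ((((⌊W⌋₊ + 1) * 2 ^ j : ℕ) : ℝ) / p + 1) ((p : ℝ) * ((n₁ : ℝ) - n₂) * θ)) := by
  classical
  have hW0 : 0 ≤ W := by linarith
  have hx0 : 0 ≤ x := by linarith
  set u₀ : ℕ := ⌊W⌋₊ + 1 with hu₀
  have hu₀0 : 0 < u₀ := by rw [hu₀]; omega
  have hu₀W : W < u₀ := by rw [hu₀]; push_cast; exact Nat.lt_floor_add_one W
  set J : ℕ := Nat.log 2 y with hJ
  set g : ℕ → ℕ := fun m => Nat.log 2 (m / u₀) with hg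
  set P := (Finset.range (y + 1)).filter Nat.Prime with hP
  set Φ := innerSum x A y θ with hΦ
  -- (1) the decomposition
  have hdec : ∑ n ∈ (Finset.Ioc ⌊A⌋₊ ⌊x⌋₊).filter (· ∈ Nat.smoothNumbers (y + 1)), (𝐞 ((n : ℝ) * θ) : ℂ) =
      ∑ m ∈ prefixSet y W, Φ (lpf m) m := by
    rw [sum_smooth_Ioc_eq_sum_sum hW1 hWA hAx (fun n : ℕ => (𝐞 ((n : ℝ) * θ) : ℂ))]
    refine Finset.sum_congr rfl fun m _ => ?_
    rw [hΦ, ← sum_cofactorSet_eq_innerSum]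
    refine Finset.sum_congr rfl fun n' _ => ?_
    push_cast; ring_nf
  -- membership facts for the prefix set
  have hMem : ∀ m ∈ prefixSet y W, u₀ ≤ m ∧ (m : ℝ) ≤ W * y ∧ m ∈ Nat.smoothNumbers (y + 1) ∧ 1 < m := by
    intro m hm
    rw [mem_prefixSet hW0] at hm
    obtain ⟨h1, h2, h3, -⟩ := hm
    have : ⌊W⌋₊ < m := (Nat.floor_lt hW0).mpr h1
    have h1' : (1 : ℝ) < m := lt_of_le_of_lt hW1 h1
    exact ⟨by rw [hu₀]; omega, h2, h3, by exact_mod_cast h1'⟩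
  have hmaps : ∀ m ∈ prefixSet y W, g m ∈ Finset.range (J + 1) := by
    intro m hm
    obtain ⟨-, hmWy, -, -⟩ := hMem m hm
    rw [Finset.mem_range, Nat.lt_succ_iff, hg, hJ]
    apply Nat.log_mono_right
    have : m / u₀ < y := by
      rw [Nat.div_lt_iff_lt_mul hu₀0]
      have h0 : (0 : ℝ) < y := by exact_mod_cast (by omega : 0 < y)
      have : (m : ℝ) < y * u₀ := by nlinarith
      exact_mod_cast this
    exact this.le
  -- (2) fibrewise + Cauchy–Schwarz
  rw [hdec, ← Finset.sum_fiberwise_of_maps_to hmaps]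
  refine (norm_sum_le _ _).trans (Finset.sum_le_sum fun j _ => ?_)
  set Mj := (prefixSet y W).filter (fun m => g m = j) with hMj
  refine (norm_sum_le_sqrt_card_mul_sqrt Mj _).trans ?_
  refine mul_le_mul_of_nonneg_left (Real.sqrt_le_sqrt ?_) (Real.sqrt_nonneg _)
  -- (3) the bound for the class `j`
  set U : ℕ := u₀ * 2 ^ j with hU
  have hU1 : 1 ≤ U := Nat.one_le_iff_ne_zero.mpr (by rw [hU]; positivity)
  -- members of `Mj` lie in `[U, 2U)`
  have hMjmem : ∀ m ∈ Mj, U ≤ m ∧ m < 2 * U ∧ m ∈ prefixSet y W := by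
    intro m hm
    rw [hMj, Finset.mem_filter] at hm
    obtain ⟨hmS, hgj⟩ := hm
    obtain ⟨hmu₀, -, -, -⟩ := hMem m hmS
    have h1 : 2 ^ j ≤ m / u₀ := by
      rw [← hgj, hg]; exact Nat.pow_log_le_self 2 (Nat.div_pos hmu₀ hu₀0).ne'
    have h2 : m / u₀ < 2 ^ (j + 1) := by
      rw [← hgj, hg]; exact Nat.lt_pow_succ_log_self one_lt_two _
    refine ⟨?_, ?_, hmS⟩
    · calc U = u₀ * 2 ^ j := hU
        _ ≤ u₀ * (m / u₀) := Nat.mul_le_mul_left _ h1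
        _ ≤ m := Nat.mul_div_le m u₀
    · calc m < u₀ * (m / u₀ + 1) := by
            have := Nat.lt_div_mul_add (a := m) hu₀0
            linarith [Nat.div_add_mod m u₀, Nat.mod_lt m hu₀0]
        _ ≤ u₀ * 2 ^ (j + 1) := Nat.mul_le_mul_left _ h2
        _ = 2 * U := by rw [hU, pow_succ]; ring
  have hlpfP : ∀ m ∈ Mj, lpf m ∈ P := by
    intro m hm
    obtain ⟨-, -, hmS⟩ := hMjmem m hm
    obtain ⟨-, -, hsm, hm1⟩ := hMem m hmS
    rw [hP, Finset.mem_filter, Finset.mem_range, Nat.lt_succ_iff]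
    exact ⟨lpf_le_of_mem_smoothNumbers hsm, lpf_prime hm1⟩
  rw [← Finset.sum_fiberwise_of_maps_to hlpfP]
  refine Finset.sum_le_sum fun p hp => ?_
  have hpP : p.Prime := (Finset.mem_filter.mp hp).2
  have hp0 : 0 < p := hpP.pos
  -- on the fibre, `Φ (lpf m) m = Φ p ((m/p) p)`; inject `m ↦ m/p`
  set F := Mj.filter (fun m => lpf m = p) with hF
  set M := (Finset.Icc 1 (2 * U)).filter (fun m' => U ≤ m' * p ∧ m' * p < 2 * U) with hM
  have hFmem : ∀ m ∈ F, p ∣ m ∧ U ≤ m ∧ m < 2 * U ∧ 1 < m := by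
    intro m hm
    rw [hF, Finset.mem_filter] at hm
    obtain ⟨hmMj, hl⟩ := hm
    obtain ⟨h1, h2, hmS⟩ := hMjmem m hmMj
    obtain ⟨-, -, -, hm1⟩ := hMem m hmS
    exact ⟨hl ▸ lpf_dvd hm1, h1, h2, hm1⟩
  have hinj : Set.InjOn (fun m : ℕ => m / p) ↑F := by
    intro m₁ hm₁ m₂ hm₂ heq
    have h1 := (hFmem m₁ (Finset.mem_coe.mp hm₁)).1
    have h2 := (hFmem m₂ (Finset.mem_coe.mp hm₂)).1
    have := congrArg (fun k => k * p) heq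
    simpa only [Nat.div_mul_cancel h1, Nat.div_mul_cancel h2] using this
  have himg : F.image (fun m => m / p) ⊆ M := by
    intro m' hm'
    rw [Finset.mem_image] at hm'
    obtain ⟨m, hm, rfl⟩ := hm'
    obtain ⟨hpm, hUm, hm2U, hm1⟩ := hFmem m hm
    have hmp : m / p * p = m := Nat.div_mul_cancel hpm
    rw [hM, Finset.mem_filter, Finset.mem_Icc, hmp]
    refine ⟨⟨?_, ?_⟩, hUm, hm2U⟩
    · exact Nat.div_pos (Nat.le_of_dvd (by omega) hpm) hp0
    · exact (Nat.div_le_self m p).trans hm2U.le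
  calc ∑ m ∈ F, ‖Φ (lpf m) m‖ ^ 2 = ∑ m ∈ F, ‖Φ p ((m / p) * p)‖ ^ 2 := by
        refine Finset.sum_congr rfl fun m hm => ?_
        rw [(Finset.mem_filter.mp hm).2, Nat.div_mul_cancel (hFmem m hm).1]
    _ = ∑ m' ∈ F.image (fun m => m / p), ‖Φ p (m' * p)‖ ^ 2 :=
        (Finset.sum_image (f := fun m' => ‖Φ p (m' * p)‖ ^ 2) hinj).symm
    _ ≤ ∑ m' ∈ M, ‖Φ p (m' * p)‖ ^ 2 :=
        Finset.sum_le_sum_of_subset_of_nonneg himg (fun _ _ _ => by positivity)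
    _ ≤ _ := by
        have := sum_normSq_innerSum_le (x := x) (A := A) (θ := θ) (y := y) hp0 hU1
        rw [← hΦ] at this
        convert this using 4

end Literature.NumberTheory.Sieve

end
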